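import Literature.NumberTheory.Weil1965.AdelicGaussTransformMajorant
import Literature.NumberTheory.Weil1965.AdelicSiegelCoeffSplitting
import HarnessLib

/-!
# Weil's condition (B) for a quadratic form: `‖F*_Φ(b)‖ ≤ C · H(b)^{−m/2}` and `Σ_b ‖F*_Φ(b)‖ < ∞`

Topic `NumberTheory/Weil1965`; namespace `Literature.NumberTheory.Weil1965`.  KERNEL mathematics only (theorems; no definition,
no named fact, no `axiom`, no `sorry`).  The bridge from the adelic Gauss-transform majorant ★ `AdelicGaussTransformMajorant`
(`∫ chirp F (η • ratMatrix S) Φ ∂μ` for ALL adeles `η`) to the Siegel–Eisenstein coefficient currency of ★ `AdelicFibreMeasures` ∕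
★ `AdelicSiegelCoeffSplitting` (`adelicSiegelCoeff F ι μ h Φ ξ = ∫ ψ_ξ(h x) Φ(x) dμ`, rational `ξ`):

* `adelicSiegelCoeff_sdForm_eq_integral_chirp` — for the quadratic map `h = q_S : x ↦ x S xᵀ` of a rational matrix `S`,
  `F*_Φ(ξ) = ∫ chirp F (ξ • ratMatrix S) Φ ∂μ`;
* `exists_norm_adelicSiegelCoeff_sdForm_le_classicalHeight` — for a totally real `F`, `S ∈ Sym_m(F)` with `det S ≠ 0` and
  `Φ ∈ 𝒮(𝔸_F^m)`: `‖F*_Φ(b)‖ ≤ C · H(b)^{−m/2}` for every `b ∈ F`, `H(b) = Π_w max(1,|b|_w)^{mult w} · Π_v max(1,|b|_v)` the classical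
  height ([Weil1965, Chap. I n° 2 Prop. 2; Chap. IV n° 41]: "le second membre de (34) est absolument convergent");
* `summable_norm_adelicSiegelCoeff_sdForm` — hence `Σ_{b ∈ F} ‖F*_Φ(b)‖ < ∞` as soon as `m > 4` (Weil's range for the rank-one
  Siegel–Eisenstein series, ★ `summable_norm_adelicSiegelCoeff_of_le_classicalHeight`, `τ = m/2 > 2`). [Weil1965, Chap. IV n° 40 Thm. 1]

Cell `hodgecm-mathlib`, FLOOR 0, crux H413 (stmt-HodgeConjecture-24833), E-2 ∕ SW2: the `hB` fold of the Φ*-3 road (p06 (g2) census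
`POISSON-Phi3-CENSUS.v0`, (B) = (HM) ∘ this file).  HC_CM is proved only modulo the 7 printed citations until rung 0 closes; this file is
unconditional.

## References
* [Weil1965] A. Weil, *Sur la formule de Siegel dans la théorie des groupes classiques*, Acta Math. 113 (1965): Chap. I n° 2
  Prop. 2 (p. 8); Chap. IV n° 40 Thm. 1 (p. 57), n° 41 (34)–(35) (p. 59).
-/

set_option autoImplicit false

noncomputable section

open MeasureTheory Filter Topology Set NumberField NumberField.InfinitePlace NumberField.mixedEmbedding IsDedekindDomain
open scoped NNReal ENNReal Matrix Classical
open Literature.NumberTheory.Automorphic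
open Literature.NumberTheory.Weil1964
open Literature.NumberTheory.GaloisRepresentations.IsNonarchimedeanLocalField (normAbs)

namespace Literature.NumberTheory.Weil1965

variable (F : Type) [Field F] [NumberField F] {m : ℕ}
  [MeasurableSpace (AdeleRing (𝓞 F) F)] [BorelSpace (AdeleRing (𝓞 F) F)]

omit [BorelSpace (AdeleRing (𝓞 F) F)] in
/-- **The Siegel–Eisenstein coefficient of the quadratic map `x ↦ x S xᵀ` is a chirp integral**:
`F*_Φ(ξ) = ∫ ψ_F(ξ · x S xᵀ) Φ(x) dμ = ∫ chirp F (ξ • ratMatrix S) Φ ∂μ`. [cite: Weil1965, Chap. IV n° 41, p. 59] -/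
theorem adelicSiegelCoeff_sdForm_eq_integral_chirp (μ : Measure (Fin m → AdeleRing (𝓞 F) F)) (S : Matrix (Fin m) (Fin m) F)
    (Φ : (Fin m → AdeleRing (𝓞 F) F) → ℂ) (ξ : F) :
    adelicSiegelCoeff F (Fin m) μ (fun x => sdForm F (ratMatrix F S) x) Φ ξ =
      ∫ x, chirp F (algebraMap F (AdeleRing (𝓞 F) F) ξ • ratMatrix F S) Φ x ∂μ := by
  rw [adelicSiegelCoeff]
  refine integral_congr_ae (Eventually.of_forall fun x => ?_)
  simp only [adeleQuotChar_mk, chirp_apply, sdChar_apply, sdForm_apply, Matrix.vecMul_smul, smul_dotProduct, smul_eq_mul]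

omit [MeasurableSpace (AdeleRing (𝓞 F) F)] [BorelSpace (AdeleRing (𝓞 F) F)] in
/-- the classical height of `b ∈ F` is the classical height of the principal adele `(b)_v`, which is at most `h(1, b)`.
[cite: Garrett2018, §2.2 (PDF p. 81)] -/
private theorem classicalHeight_le_vecHeight_algebraMap (b : F) :
    (∏ w : InfinitePlace F, (max 1 ‖((b : F) : w.Completion)‖₊) ^ w.mult) *
        ∏ᶠ v : HeightOneSpectrum (𝓞 F), max 1 ‖((b : F) : v.adicCompletion F)‖₊ ≤
      vecHeight F (![1, algebraMap F (AdeleRing (𝓞 F) F) b] : Fin 2 → AdeleRing (𝓞 F) F) :=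
  classicalHeight_le_vecHeight_vecCons_one_adele F (algebraMap F (AdeleRing (𝓞 F) F) b)

/-- **WEIL'S CONDITION (B), POINTWISE**: for a totally real `F`, `S ∈ Sym_m(F)` with `det S ≠ 0`, `Φ ∈ 𝒮(𝔸_F^m)` and a Haar
measure `μ`, there is `C ≥ 0` with `‖F*_Φ(b)‖ ≤ C · H(b)^{−m/2}` for every `b ∈ F`, `H` the classical height.
[cite: Weil1965, Chap. I n° 2 Prop. 2, p. 8; Chap. IV n° 41, p. 59] -/
theorem exists_norm_adelicSiegelCoeff_sdForm_le_classicalHeight [IsTotallyReal F] (μ : Measure (Fin m → AdeleRing (𝓞 F) F))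
    [μ.IsAddHaarMeasure] {S : Matrix (Fin m) (Fin m) F} (hS : S.IsSymm) (hdet : S.det ≠ 0)
    {Φ : (Fin m → AdeleRing (𝓞 F) F) → ℂ} (hΦ : Φ ∈ piSchwartzBruhat F (Fin m)) :
    ∃ C : ℝ, 0 ≤ C ∧ ∀ b : F,
      ‖adelicSiegelCoeff F (Fin m) μ (fun x => sdForm F (ratMatrix F S) x) Φ b‖ ≤ C *
        ((((∏ w : InfinitePlace F, (max 1 ‖((b : F) : w.Completion)‖₊) ^ w.mult) *
          ∏ᶠ v : HeightOneSpectrum (𝓞 F), max 1 ‖((b : F) : v.adicCompletion F)‖₊ : ℝ≥0) : ℝ)) ^ (-((m : ℝ) / 2)) := by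
  obtain ⟨A, hA0, hA⟩ := exists_norm_integral_chirp_smul_ratMatrix_le_vecHeight F μ hS hdet hΦ
  refine ⟨A, hA0, fun b => ?_⟩
  rw [adelicSiegelCoeff_sdForm_eq_integral_chirp]
  refine (hA _).trans (mul_le_mul_of_nonneg_left ?_ hA0)
  have h1 : (1 : ℝ≥0) ≤ (∏ w : InfinitePlace F, (max 1 ‖((b : F) : w.Completion)‖₊) ^ w.mult) *
      ∏ᶠ v : HeightOneSpectrum (𝓞 F), max 1 ‖((b : F) : v.adicCompletion F)‖₊ :=
    one_le_classicalHeight_adele F (algebraMap F (AdeleRing (𝓞 F) F) b)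
  have hpos : (0 : ℝ) < (((∏ w : InfinitePlace F, (max 1 ‖((b : F) : w.Completion)‖₊) ^ w.mult) *
      ∏ᶠ v : HeightOneSpectrum (𝓞 F), max 1 ‖((b : F) : v.adicCompletion F)‖₊ : ℝ≥0) : ℝ) :=
    lt_of_lt_of_le zero_lt_one (by exact_mod_cast h1)
  exact Real.rpow_le_rpow_of_nonpos hpos (by exact_mod_cast classicalHeight_le_vecHeight_algebraMap F b)
    (neg_nonpos.2 (by positivity))

/-- **WEIL'S CONDITION (B)** for the quadratic map `x ↦ x S xᵀ` in `m > 4` variables over a totally real field: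
`Σ_{b ∈ F} ‖F*_Φ(b)‖ < ∞` for every `Φ ∈ 𝒮(𝔸_F^m)` (`τ = m/2 > 2`, ★ `summable_norm_adelicSiegelCoeff_of_le_classicalHeight`).
[cite: Weil1965, Chap. IV n° 40 Thm. 1, p. 57; n° 41, p. 59] -/
theorem summable_norm_adelicSiegelCoeff_sdForm [IsTotallyReal F] (μ : Measure (Fin m → AdeleRing (𝓞 F) F))
    [μ.IsAddHaarMeasure] (hm : 4 < m) {S : Matrix (Fin m) (Fin m) F} (hS : S.IsSymm) (hdet : S.det ≠ 0)
    {Φ : (Fin m → AdeleRing (𝓞 F) F) → ℂ} (hΦ : Φ ∈ piSchwartzBruhat F (Fin m)) :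
    Summable fun b : F => ‖adelicSiegelCoeff F (Fin m) μ (fun x => sdForm F (ratMatrix F S) x) Φ b‖ := by
  obtain ⟨C, -, hC⟩ := exists_norm_adelicSiegelCoeff_sdForm_le_classicalHeight F μ hS hdet hΦ
  have hτ : (2 : ℝ) < (m : ℝ) / 2 := by
    have : (4 : ℝ) < m := by exact_mod_cast hm
    linarith
  exact summable_norm_adelicSiegelCoeff_of_le_classicalHeight F (Fin m) hτ C hC

end Literature.NumberTheory.Weil1965

end
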